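import Mathlib
import HarnessLib

/-!
# Enflo 2023, v2 p.20: the type-2 threshold `L₀`

Source under adjudication: Per H. Enflo, *On the invariant subspace problem in Hilbert spaces*, arXiv:2305.15442 (v1
2023, v2 2024), bib key `Enflo2023` — a CLAIMED proof of the invariant subspace problem for operators on a separable
Hilbert space.  This file is part of the kernel-tight typing of the manuscript by the b2b-enflo repair cell
(formaliser 2, Part B: (28)–(47), the limiting argument and the final deduction).  It records what FOLLOWS (proved
implications from the manuscript's displayed hypotheses) and, where a step does not follow, the typed inference
together with its refutation.  NOTHING here asserts that the manuscript's main theorem holds; no declaration concludes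
the invariant subspace problem for an arbitrary operator.  Value (BLOCK-2b): theorems / refutations of typed
inferences about a text — not progress on the problem.

EnfloISP — Part B (formaliser 2).  v2 p.20 (type 2): "We will first show that there exists L₀ > 0 such that
for L < L₀, there exists M(L) = M such that if we move y₀ + L s_n within distance 0.3 of x₀ by minimal ℓ'_n,
‖ℓ'_n(T)(y₀ + L s_n) − x₀‖ ≤ 0.3, then ‖ℓ'_n‖₂ ≤ M for all n.  But, if L > L₀ there is no such M."
Write Good L :⇔ "∃ M, ∀ n, the minimal ℓ'_n for y₀ + L s_n has ‖ℓ'_n‖₂ ≤ M".  The paper proves two things: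
Good L for all small L > 0 (p.20 bottom, "L₀ > 0") and ¬ Good L for some L (p.21, the contradiction via
(20)–(21)).  From these, what FOLLOWS is the threshold statement below with L₀ := inf of the failure set;
clause (iii) — failures at or just above L₀ — is exactly what (47) uses.  The paper's stronger wording
"if L > L₀ there is no such M" for EVERY L > L₀ would need Good to be an initial segment (monotone in L), which
is not argued; we record this as a MISSTATEMENT WITH A SUFFICIENT REPAIR (STEPS.md row B-T2-1), not as the gap.
STATUS: CLOSED (zero sorry).
-/

namespace Literature.Analysis.OperatorTheory.Enflo2023

/-- The threshold lemma (real analysis only). [cite: Enflo2023, v2 p.20] -/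
theorem threshold (Good : ℝ → Prop) (ε : ℝ) (hsmall : ∀ L, 0 < L → L < ε → Good L)
    (Lbad : ℝ) (hLbad : 0 < Lbad) (hbad : ¬ Good Lbad) :
    ∃ L₀ : ℝ, ε ≤ L₀ ∧ (∀ L, 0 < L → L < L₀ → Good L) ∧
      ∀ δ > 0, ∃ L, L₀ ≤ L ∧ L < L₀ + δ ∧ 0 < L ∧ ¬ Good L := by
  set S : Set ℝ := {L | 0 < L ∧ ¬ Good L} with hS
  have hne : S.Nonempty := ⟨Lbad, hLbad, hbad⟩
  have hlb : ∀ L ∈ S, ε ≤ L := fun L hL =>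
    le_of_not_gt fun h => hL.2 (hsmall L hL.1 h)
  have hbdd : BddBelow S := ⟨ε, hlb⟩
  refine ⟨sInf S, le_csInf hne hlb, fun L hL hlt => ?_, fun δ hδ => ?_⟩
  · by_contra hG
    have : sInf S ≤ L := csInf_le hbdd ⟨hL, hG⟩
    linarith
  · obtain ⟨L, hLS, hLlt⟩ := exists_lt_of_csInf_lt hne (show sInf S < sInf S + δ by linarith)
    exact ⟨L, csInf_le hbdd hLS, hLlt, hLS.1, hLS.2⟩

/-- In particular `0 < L₀`. [cite: Enflo2023, v2 p.20] -/
theorem threshold_pos (Good : ℝ → Prop) (ε : ℝ) (hε : 0 < ε) (hsmall : ∀ L, 0 < L → L < ε → Good L)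
    (Lbad : ℝ) (hLbad : 0 < Lbad) (hbad : ¬ Good Lbad) :
    ∃ L₀ : ℝ, 0 < L₀ ∧ (∀ L, 0 < L → L < L₀ → Good L) ∧
      ∀ δ > 0, ∃ L, L₀ ≤ L ∧ L < L₀ + δ ∧ 0 < L ∧ ¬ Good L := by
  obtain ⟨L₀, h1, h2, h3⟩ := threshold Good ε hsmall Lbad hLbad hbad
  exact ⟨L₀, lt_of_lt_of_le hε h1, h2, h3⟩

/-- Why the paper's stronger wording needs more: without monotonicity, `Good` can fail at `L₀` and hold again
above it.  Model: Good L :⇔ L ≠ 1 (good below 1, bad at 1, good again above). -/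
example : ∃ Good : ℝ → Prop, (∀ L, 0 < L → L < 1 → Good L) ∧ ¬ Good 1 ∧ Good 2 :=
  ⟨fun L => L ≠ 1, fun L _ h => ne_of_lt h, fun h => h rfl, by norm_num⟩

end Literature.Analysis.OperatorTheory.Enflo2023
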